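import Summits.Ventures.LatticeQCDFlow.Scoring.BesselToeplitzLaplace
import Mathlib.Analysis.Calculus.ParametricIntegral
import Mathlib.Analysis.SpecialFunctions.Pow.Deriv
import HarnessLib

/-!
# The second moment of the Gaussian–Vandermonde law: `∫_{ℝ^N} |φ|² e^{−|φ|²/2} Π_{j≺k}(φ_j − φ_k)² dφ = N² · M_N` (the GUE identity `E tr H² = N²`), by scaling

HONEST FRAMING: exact (Metropolis-corrected) sampling algorithms for lattice gauge theory;
figures of merit are autocorrelation/cost numbers at stated couplings and volumes; no
continuum-physics claim.

Venture `LatticeQCDFlow` (cell pub-lqcd), sub-topic `Scoring`; FANOUT row 5 (`s0-sun-a`), GEN-20.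
NEW WORK of the cell (placement rule).  Input of the weak-coupling law of the MEAN PLAQUETTE (`β(1 − P_N(β)) → N/2`,
sibling file): with `M_N = ∫ e^{−Σφ²/2} Π_{j≺k}(φ_j − φ_k)²` (GEN-20 `BesselToeplitzLaplace`, Mehta's integral),

* §1 `integrable_gaussPolyBound` (the dominating family `C Π_b e^{−(2/π²)φ_b²}(1 + φ_b²)^M` is integrable for every `M`),
  `sum_sq_le_prod_one_add_sq` (`Σ φ_b² ≤ Π (1 + φ_b²)`);
* §2 **`integral_gaussVandermonde_scale`** — the scaling law `∫ e^{−tΣφ²/2} Π(φ_j − φ_k)² dφ = M_N / √t^{N²}` (`t > 0`;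
  `φ ↦ √t φ`, `Measure.integral_comp_smul`, `|n| + 2|OD| = N²`);
* §3 **`integral_normSq_gaussVandermonde`** — differentiating the scaling law at `t = 1` under the integral sign
  (`hasDerivAt_integral_of_dominated_loc_of_deriv_le`): `∫ (Σ_b φ_b²) e^{−Σφ²/2} Π(φ_j − φ_k)² dφ = N² · M_N`.

No `def`, nothing cited as a fact, 0 sorry.
-/

noncomputable section

open Real MeasureTheory Filter Topology Finset
open Literature.RepresentationTheory.CompactGroups.WeylIntegration (OD enum)

namespace Summit.Ventures.LatticeQCDFlow.Scoring

section GUE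

variable {n : Type*} [Fintype n]

/-! ### 1. Dominating family -/

/-- `C · Π_b e^{−(2/π²)φ_b²}(1 + φ_b²)^M` is integrable on `ℝ^N` for every `M`. -/
theorem integrable_gaussPolyBound (C : ℝ) (M : ℕ) :
    Integrable (fun φ : n → ℝ => C * ∏ b, (Real.exp (-(2 / π ^ 2 * φ b ^ 2)) * (1 + φ b ^ 2) ^ M)) := by
  refine Integrable.const_mul ?_ _
  rw [volume_pi]
  refine Integrable.fintype_prod (f := fun _ t => Real.exp (-(2 / π ^ 2 * t ^ 2)) * (1 + t ^ 2) ^ M) fun b => ?_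
  have hc : (0 : ℝ) < 2 / π ^ 2 := by positivity
  have hg : Integrable (fun t : ℝ => (M.factorial * (2 / (2 / π ^ 2)) ^ M * Real.exp ((2 / π ^ 2) / 2)) *
      Real.exp (-((2 / π ^ 2) / 2 * t ^ 2))) := by
    refine Integrable.const_mul ?_ _
    have h := integrable_exp_neg_mul_sq (b := (2 / π ^ 2) / 2) (by positivity)
    refine h.congr (Eventually.of_forall fun t => ?_)
    simp only [neg_mul]
  refine Integrable.mono' hg ((by fun_prop : Continuous fun t : ℝ =>
      Real.exp (-(2 / π ^ 2 * t ^ 2)) * (1 + t ^ 2) ^ M).aestronglyMeasurable) (Eventually.of_forall fun t => ?_)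
  rw [Real.norm_eq_abs, abs_of_nonneg (by positivity), mul_comm]
  exact one_add_sq_pow_mul_exp_le hc M t

/-- `Σ_b φ_b² ≤ Π_b (1 + φ_b²)`. -/
theorem sum_sq_le_prod_one_add_sq (φ : n → ℝ) : ∑ b, φ b ^ 2 ≤ ∏ b, (1 + φ b ^ 2) := by
  classical
  induction (Finset.univ : Finset n) using Finset.induction_on with
  | empty => simp
  | @insert j s hj ih =>
    rw [Finset.sum_insert hj, Finset.prod_insert hj]
    have hP : 1 ≤ ∏ k ∈ s, (1 + φ k ^ 2) := Finset.one_le_prod fun k _ => by nlinarith [sq_nonneg (φ k)]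
    nlinarith [sq_nonneg (φ j), Finset.sum_nonneg (fun k (_ : k ∈ s) => sq_nonneg (φ k))]

/-! ### 2. The scaling law -/

variable [DecidableEq n]

/-- **Scaling law**: `∫ e^{−tΣφ_b²/2} Π_{j≺k}(φ_j − φ_k)² dφ = M_N / √t^{N²}` for `t > 0`. -/
theorem integral_gaussVandermonde_scale {t : ℝ} (ht : 0 < t) :
    ∫ φ : n → ℝ, Real.exp (∑ b, -(t * φ b ^ 2 / 2)) * ∏ p : OD n, (φ p.1.1 - φ p.1.2) ^ 2
      = (∫ φ : n → ℝ, Real.exp (∑ b, -(φ b ^ 2 / 2)) * ∏ p : OD n, (φ p.1.1 - φ p.1.2) ^ 2) /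
          √t ^ (Fintype.card n ^ 2) := by
  have hs : 0 < √t := Real.sqrt_pos.2 ht
  set F : (n → ℝ) → ℝ := fun φ => Real.exp (∑ b, -(φ b ^ 2 / 2)) * ∏ p : OD n, (φ p.1.1 - φ p.1.2) ^ 2 with hF
  -- `F(√t • φ) = √t^{2|OD|} · (scaled integrand)`
  have hpt : ∀ φ : n → ℝ, F (√t • φ)
      = √t ^ (2 * Fintype.card (OD n)) * (Real.exp (∑ b, -(t * φ b ^ 2 / 2)) * ∏ p : OD n, (φ p.1.1 - φ p.1.2) ^ 2) := by
    intro φ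
    simp only [hF, Pi.smul_apply, smul_eq_mul]
    have h1 : ∑ b, -((√t * φ b) ^ 2 / 2) = ∑ b, -(t * φ b ^ 2 / 2) := by
      refine Finset.sum_congr rfl fun b _ => ?_
      rw [mul_pow, Real.sq_sqrt ht.le]
    have h2 : ∏ p : OD n, (√t * φ p.1.1 - √t * φ p.1.2) ^ 2 = √t ^ (2 * Fintype.card (OD n)) *
        ∏ p : OD n, (φ p.1.1 - φ p.1.2) ^ 2 := by
      have hc : ∏ _p : OD n, √t ^ 2 = √t ^ (2 * Fintype.card (OD n)) := by
        rw [Finset.prod_const, Finset.card_univ, ← pow_mul, mul_comm]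
      rw [← hc, ← Finset.prod_mul_distrib]
      exact Finset.prod_congr rfl fun p _ => by ring
    rw [h1, h2]
    ring
  have hcomp := Measure.integral_comp_smul volume F (√t)
  rw [Module.finrank_fintype_fun_eq_card, smul_eq_mul] at hcomp
  simp_rw [hpt] at hcomp
  rw [integral_const_mul] at hcomp
  -- solve
  have hcard : Fintype.card n ^ 2 = Fintype.card n + 2 * Fintype.card (OD n) := (card_add_two_mul_card_OD (n := n)).symm
  have habs : |(√t ^ Fintype.card n)⁻¹| = (√t ^ Fintype.card n)⁻¹ := abs_of_pos (by positivity)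
  rw [habs] at hcomp
  rw [hcard, pow_add, eq_div_iff (by positivity)]
  have hne : √t ^ (2 * Fintype.card (OD n)) ≠ 0 := by positivity
  calc (∫ φ : n → ℝ, Real.exp (∑ b, -(t * φ b ^ 2 / 2)) * ∏ p : OD n, (φ p.1.1 - φ p.1.2) ^ 2) *
        (√t ^ Fintype.card n * √t ^ (2 * Fintype.card (OD n)))
      = (√t ^ (2 * Fintype.card (OD n)) * ∫ φ : n → ℝ, Real.exp (∑ b, -(t * φ b ^ 2 / 2)) *
          ∏ p : OD n, (φ p.1.1 - φ p.1.2) ^ 2) * √t ^ Fintype.card n := by ring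
    _ = (√t ^ Fintype.card n)⁻¹ * (∫ φ, F φ) * √t ^ Fintype.card n := by rw [hcomp]
    _ = ∫ φ, F φ := by field_simp

/-! ### 3. The second moment by differentiation under the integral sign -/

/-- **`∫ (Σ_b φ_b²) e^{−Σφ²/2} Π_{j≺k}(φ_j − φ_k)² dφ = N² · M_N`** (the GUE identity `E tr H² = N²` for the
eigenvalue density `∝ e^{−Σφ²/2} Δ(φ)²`). -/
theorem integral_normSq_gaussVandermonde :
    ∫ φ : n → ℝ, (∑ b, φ b ^ 2) * (Real.exp (∑ b, -(φ b ^ 2 / 2)) * ∏ p : OD n, (φ p.1.1 - φ p.1.2) ^ 2)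
      = (Fintype.card n : ℝ) ^ 2 *
        ∫ φ : n → ℝ, Real.exp (∑ b, -(φ b ^ 2 / 2)) * ∏ p : OD n, (φ p.1.1 - φ p.1.2) ^ 2 := by
  set M : ℝ := ∫ φ : n → ℝ, Real.exp (∑ b, -(φ b ^ 2 / 2)) * ∏ p : OD n, (φ p.1.1 - φ p.1.2) ^ 2 with hM
  -- the family `F t φ = e^{−tΣφ²/2} Δ²` and its `t`-derivative
  set F : ℝ → (n → ℝ) → ℝ := fun t φ => Real.exp (∑ b, -(t * φ b ^ 2 / 2)) * ∏ p : OD n, (φ p.1.1 - φ p.1.2) ^ 2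
    with hF
  set F' : ℝ → (n → ℝ) → ℝ := fun t φ => -((∑ b, φ b ^ 2) / 2) *
    (Real.exp (∑ b, -(t * φ b ^ 2 / 2)) * ∏ p : OD n, (φ p.1.1 - φ p.1.2) ^ 2) with hF'
  have hcont : ∀ t, Continuous (F t) := fun t => by simp only [hF]; fun_prop
  have hcont' : ∀ t, Continuous (F' t) := fun t => by simp only [hF']; fun_prop
  -- pointwise derivative in `t`
  have hderiv : ∀ φ : n → ℝ, ∀ t : ℝ, HasDerivAt (fun s => F s φ) (F' t φ) t := by
    intro φ t
    simp only [hF, hF']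
    have h1 : HasDerivAt (fun s : ℝ => ∑ b, -(s * φ b ^ 2 / 2)) (-((∑ b, φ b ^ 2) / 2)) t := by
      have : (fun s : ℝ => ∑ b, -(s * φ b ^ 2 / 2)) = fun s => s * (-((∑ b, φ b ^ 2) / 2)) := by
        funext s
        rw [mul_neg, Finset.sum_div, Finset.mul_sum, ← Finset.sum_neg_distrib]
        exact Finset.sum_congr rfl fun b _ => by ring
      rw [this]
      simpa using (hasDerivAt_id t).mul_const (-((∑ b, φ b ^ 2) / 2))
    have h2 := h1.exp.mul_const (∏ p : OD n, (φ p.1.1 - φ p.1.2) ^ 2)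
    refine h2.congr_deriv ?_
    ring
  -- domination on `t ∈ (1/2, 3/2)`: `|F' t φ| ≤ (Σφ²/2) e^{−Σφ²/4} Δ² ≤ 2^m Π e^{−(2/π²)φ²}(1+φ²)^{m+1}`
  have hbound : ∀ φ : n → ℝ, ∀ t ∈ Set.Ioo (1 / 2 : ℝ) (3 / 2), ‖F' t φ‖
      ≤ 2 ^ Fintype.card (OD n) * ∏ b, (Real.exp (-(2 / π ^ 2 * φ b ^ 2)) * (1 + φ b ^ 2) ^ (Fintype.card (OD n) + 1)) := by
    intro φ t ht
    simp only [hF', Real.norm_eq_abs]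
    rw [abs_mul, abs_neg, abs_of_nonneg (by positivity), abs_of_nonneg (mul_nonneg (Real.exp_nonneg _)
      (Finset.prod_nonneg fun p _ => sq_nonneg _))]
    -- Gaussian part: `e^{−tφ²/2} ≤ e^{−(2/π²)φ²}` for `t > 1/2` (`2/π² < 1/4`)
    have hexp : Real.exp (∑ b, -(t * φ b ^ 2 / 2)) ≤ ∏ b, Real.exp (-(2 / π ^ 2 * φ b ^ 2)) := by
      rw [← Real.exp_sum]
      refine Real.exp_le_exp.2 (Finset.sum_le_sum fun b _ => ?_)
      have hπ : 2 / π ^ 2 ≤ 1 / 4 := by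
        rw [div_le_div_iff₀ (by positivity) (by norm_num)]
        nlinarith [Real.pi_gt_three]
      nlinarith [sq_nonneg (φ b), ht.1]
    have hmain := mul_prod_le_laplaceBound φ hexp (fun p => sq_nonneg _) (fun p => le_rfl)
    have hsum : (∑ b, φ b ^ 2) / 2 ≤ ∏ b, (1 + φ b ^ 2) := by
      have := sum_sq_le_prod_one_add_sq φ
      have h0 : 0 ≤ ∑ b, φ b ^ 2 := Finset.sum_nonneg fun b _ => sq_nonneg _
      linarith
    calc (∑ b, φ b ^ 2) / 2 * (Real.exp (∑ b, -(t * φ b ^ 2 / 2)) * ∏ p : OD n, (φ p.1.1 - φ p.1.2) ^ 2)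
        ≤ (∏ b, (1 + φ b ^ 2)) * (2 ^ Fintype.card (OD n) *
          ∏ b, (Real.exp (-(2 / π ^ 2 * φ b ^ 2)) * (1 + φ b ^ 2) ^ Fintype.card (OD n))) :=
          mul_le_mul hsum hmain (mul_nonneg (Real.exp_nonneg _) (Finset.prod_nonneg fun p _ => sq_nonneg _))
            (Finset.prod_nonneg fun b _ => by positivity)
      _ = 2 ^ Fintype.card (OD n) * ∏ b, (Real.exp (-(2 / π ^ 2 * φ b ^ 2)) * (1 + φ b ^ 2) ^ (Fintype.card (OD n) + 1)) := by
          rw [mul_left_comm, ← Finset.prod_mul_distrib]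
          congr 1
          exact Finset.prod_congr rfl fun b _ => by ring
  have hint1 : Integrable (F 1) := by
    refine Integrable.mono' integrable_laplaceBound (hcont 1).aestronglyMeasurable (Eventually.of_forall fun φ => ?_)
    rw [Real.norm_eq_abs, abs_of_nonneg (mul_nonneg (Real.exp_nonneg _) (Finset.prod_nonneg fun p _ => sq_nonneg _))]
    simp only [one_mul]
    refine mul_prod_le_laplaceBound φ ?_ (fun p => sq_nonneg _) (fun p => le_rfl)
    rw [← Real.exp_sum]
    refine Real.exp_le_exp.2 (Finset.sum_le_sum fun b _ => ?_)
    have hπ : 2 / π ^ 2 ≤ 1 / 2 := by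
      rw [div_le_div_iff₀ (by positivity) (by norm_num)]
      nlinarith [Real.pi_gt_three]
    nlinarith [sq_nonneg (φ b)]
  have hD := hasDerivAt_integral_of_dominated_loc_of_deriv_le (μ := (volume : Measure (n → ℝ))) (x₀ := (1 : ℝ))
    (F := F) (F' := F') (s := Set.Ioo (1 / 2 : ℝ) (3 / 2)) (Ioo_mem_nhds (by norm_num) (by norm_num))
    (Eventually.of_forall fun t => (hcont t).aestronglyMeasurable) hint1 (hcont' 1).aestronglyMeasurable
    (Eventually.of_forall fun φ t ht => hbound φ t ht) (integrable_gaussPolyBound _ _)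
    (Eventually.of_forall fun φ t _ => hderiv φ t)
  -- the same derivative from the scaling law: `d/dt (M/√t^{N²}) = −(N²/2) M` at `t = 1`
  have hscale : ∀ᶠ t : ℝ in 𝓝 1, ∫ φ, F t φ = M * (t ^ (-((Fintype.card n : ℝ) ^ 2 / 2))) := by
    filter_upwards [Ioo_mem_nhds (show (1 / 2 : ℝ) < 1 by norm_num) (show (1 : ℝ) < 3 / 2 by norm_num)] with t ht
    have ht0 : 0 < t := by linarith [ht.1]
    show (∫ φ : n → ℝ, Real.exp (∑ b, -(t * φ b ^ 2 / 2)) * ∏ p : OD n, (φ p.1.1 - φ p.1.2) ^ 2) = _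
    rw [integral_gaussVandermonde_scale ht0, hM.symm, Real.sqrt_eq_rpow, ← Real.rpow_natCast,
      ← Real.rpow_mul ht0.le, Real.rpow_neg ht0.le, div_eq_mul_inv]
    congr 2
    push_cast
    ring
  have hD2 : HasDerivAt (fun t : ℝ => ∫ φ, F t φ) (M * (-((Fintype.card n : ℝ) ^ 2 / 2))) 1 := by
    have h := (Real.hasDerivAt_rpow_const (x := (1 : ℝ)) (p := -((Fintype.card n : ℝ) ^ 2 / 2))
      (Or.inl one_ne_zero)).const_mul M
    simp only [Real.one_rpow, mul_one] at h
    exact h.congr_of_eventuallyEq hscale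
  have huniq := hD.2.unique hD2
  -- `∫ F' 1 = −(1/2) ∫ (Σφ²) e^{−Σφ²/2} Δ²`
  have hF'1 : ∫ φ, F' 1 φ = -(1 / 2) * ∫ φ : n → ℝ, (∑ b, φ b ^ 2) *
      (Real.exp (∑ b, -(φ b ^ 2 / 2)) * ∏ p : OD n, (φ p.1.1 - φ p.1.2) ^ 2) := by
    rw [← integral_const_mul]
    refine integral_congr_ae (Eventually.of_forall fun φ => ?_)
    simp only [hF', one_mul]
    ring
  rw [hF'1] at huniq
  have : ∫ φ : n → ℝ, (∑ b, φ b ^ 2) * (Real.exp (∑ b, -(φ b ^ 2 / 2)) * ∏ p : OD n, (φ p.1.1 - φ p.1.2) ^ 2)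
      = (Fintype.card n : ℝ) ^ 2 * M := by linarith
  rw [this]

end GUE

end Summit.Ventures.LatticeQCDFlow.Scoring
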